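import Summits.AtomisticToContinuum.HydrodynamicLimit.Theses.AntiMazurCoboundaries
import Literature.MathematicalPhysics.KineticTheory.HardSphereEulerProofs
import Summits.AtomisticToContinuum.HydrodynamicLimit.Theorems.ShearStressHalfDrude.Negative.WithoutOrth
import Summits.AtomisticToContinuum.HydrodynamicLimit.Theorems.ShearStressHalfDrude.Negative.FalseForAllN

/-!
# Line `velocity-resampling-cutoff` — crux `AntiMazurCoboundaries.ShearStressHalfDrude`
(stmt-AtomisticToContinuum-14136)

Skeleton (crux-plan, round 1) of crux idea `velocity-resampling-cutoff` (ideator 1; triage r1-1/2/3: pass ×3,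
sharpenings folded in below).

THE CRUX. For constant profiles `(a, θ, u₀)` there is `σ₀` such that for `σ < σ₀`, every pair `e₁ ⊥ e₂`, EVERY
cutoff `A > 0`, the cutoff shear stress `g_A(w) = ⟨e₁,w⟩⟨e₂,w⟩(1 − smoothTransition(‖w‖²/A² − 1))` and every
continuous `φ`, some kinetic window `τ` and `N₀` give `W_N := ∫ (h⁻¹∫₀ʰ F∘Φ_s)² dG_N ≤ ½ (N+1)∫φ²∫g_A²dγ`
(`h = τ(N+1)^{-1/3}`, `F = Σᵢ φ(xᵢ) g_A(wᵢ)`, `wᵢ = (vᵢ − u₀)/√θ`) for all `N ≥ N₀` and every flow.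

THE ONE HIDDEN NON-COMPACTNESS (card §Why it bites). `∃σ₀` precedes `∀A`; the normalised stresses
`g_A/‖g_A‖_γ` converge in `L²(γ)` as `A → ∞` (to `⟨e₁,w⟩⟨e₂,w⟩`) but CONCENTRATE at `w = 0` as `A → 0`
(`‖g_A‖_∞‖g_A‖_{L¹(γ)} ≍ ‖g_A‖²_γ ≍ A⁷` while `‖g_A‖²_∞ ≍ A⁴`): every collective validity engine pays
`sup × L²` and cannot be `A`-uniform at the slow end. The line splits `∀A` into three regimes glued at ABSOLUTE
hand-off cutoffs, and treats the slow end by EXACT STRUCTURE of the product-Gaussian velocity law of `G_N`: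

* `A ≤ A₀` (slow end, THIS card): `W = Self + Distinct`.
  - SELF part (stubs 1–2): by translation invariance the one-particle two-time covariance factorises as
    `∫φ² · E[g_A(wᵢ(t))g_A(wᵢ(0))]` up to a φ-freezing error, and the tagged velocity autocorrelation obeys a
    MASS-RELATIVE decay law `E[k(wᵢ(t))k(wᵢ(0))] ≤ e^{-λt}‖k‖²_γ + η‖k‖_∞‖k‖_{L¹(γ)}` (stub 1, the bet: the tilt
    `k(wᵢ(0))` sits on a variable INDEPENDENT of everything else under `G_N`, so sup-norm tagged validity is linear in
    the relative density and the `L¹` pairing repays it; Boltzmann shadow = the PROVED tagged gap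
    `TaggedSphereSpectralGap.exists_spectralGap` × `collisionFrequency_zero_pos`). Since
    `‖g_A‖_∞‖g_A‖₁ ≤ K‖g_A‖²_γ` uniformly on `(0, A₁]`, the self window fraction is `≤ 2/(λS) + Kη` — `A`-uniform.
  - DISTINCT part (stub 3): resample `w_j(0)` (exact: `E_γ g_A = 0`, `w_j ⊥ rest`), so `E[aᵢ(t)a_j(0)]` lives on
    `{j ∈ BC_i(t)}`; two slowness indicators (`w_j(0)`, `wᵢ(t)` slow) against ONE cluster-membership event give
    `|Distinct| ≤ C(S)·A²·V` (worst case: head-on transfer, solid angle `A²`), so `A₀(η,S)` is σ-FREE.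
* `A₀ ≤ A ≤ A₁` (stub 4, DELEGATED): the collective engine of the companion lines (`fixed-budget-signed-hierarchy`:
  fixed-ε BGSS with localised cluster restriction; `cutoff-compactness-net`: `BoltzmannGreenKubo`(13985)|net +
  `FrozenModulation`) in its weakest sufficient output form — Drude fraction `≤ r` on cutoff COMPACTS, `σ₀` after `r`.
* `A ≥ A₁` (stubs 5–6): the window second moment is `L²(γ)`-Lipschitz in centred `g` uniformly in `N, τ, σ, Φ`
  (stub 5 = card's `CutoffContinuity` = `NetLipschitz` of ideator 2, provable now) and the cutoff family is
  `L²(γ)`-Cauchy at infinity with explicit Gaussian norms (stub 6, provable now): slack `½ − r` at `A₁` pays the tail.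

DISPROOF HONOURED (`Cruxes/ShearStressHalfDrude/Disproof.lean`, cycle 1): `shearStressHalfDrudeAllN_false` — every
regime's decay is collisional and sits behind `∃N₀` (stubs 1, 3, 4 all carry `∃ N₀`); `WO.shearStressHalfDrudeWithoutOrth_false`
— centring is used THREE times by name: stub 1 asks `∫k dγ = 0`, stub 3's resampling identity needs `E_γ g_A = 0`,
stub 5 is stated for centred `g, g'` only (else cross terms are `O(N²)`), and stub 6 supplies `∫g_A dγ = 0` from
`e₁ ⊥ e₂`; `ShearStressHalfDrudeTauUniformInSigma` (false on paper) — every window here is `τ = S/(σ²√θ)`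
(`kineticTau`), chosen AFTER `σ`; `ShearStressHalfDrudeUniform` (plausible) — not assumed. Negatives index (12 refuted,
measurability/junk witnesses): all functionals below are lintegrals or Bochner integrals of bounded continuous
integrands against probability measures.

COMPANION SKELETON (`Lines/fixed-budget-signed-hierarchy.lean`, namespace `…FixedBudgetSignedHierarchy`, published while
this one was written): its `EnvelopeAwayFromRest ∧ WindowBudget ∧ StaticShearVariance` restricted to cutoff compacts IMPLY
stub 4 below (`S := 4/(λr)`, `η := r/2`), and its open `stub_slowEndEnvelope` (`EnvelopeSlowEnd`, pointwise two-time
currency) is exactly what stubs 1–3 below deliver in window currency — the two skeletons are the two halves of ONE design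
(triage r1-1/2: "{fixed-budget-signed-hierarchy, velocity-resampling-cutoff} = engine on compacts + slow end"); a lead may
take stubs 1–3 + 5–6 here and `stub_singleObservableEnvelope` + `stub_cutoffCompactification` + `stub_windowBudget` there.

COMPOSITION (sorry-free, `shearStressHalfDrude_of_parts`): `η = r = ε = 1/8`; `S₀(η)` from stub 2, `A₀(η,S₀)` from
stub 3, `A⋆(ε)` from stub 6, `A₁ := max A₀ A⋆`, `σ₀ := min(σ_engine(r,A₀,A₁), σ_self(A₀), σ_dist, ½)`; per `A`:
slow `W ≤ Self + V/8 ≤ V/4`; compact `W ≤ V/8`; tail `W(g_A) ≤ W(g_{A₁}) + K(√n+√n₁)√d ≤ KE/8 + KE/4 ≤ ½K(7E/8) ≤ ½Kn`.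
`ShearStressHalfDrude_of : ShearStressHalfDrude` BY NAME from the six registered stubs.
-/

noncomputable section

open MeasureTheory ProbabilityTheory Set Filter Topology
open scoped ENNReal

namespace Summit.AtomisticToContinuum.HydrodynamicLimit.Cruxes.ShearStressHalfDrude.VelocityResamplingCutoff

open Literature.MathematicalPhysics.KineticTheory (T3 V3 hsDiameter localGibbsLaw)
open Literature.Analysis.FluidPDE (HardSphereFlow Config)
open Summit.AtomisticToContinuum.HydrodynamicLimit.Theses.AntiMazurCoboundaries (ShearStressHalfDrude)

/-! ## Frame (reducible abbreviations + the crux's functionals, spelled exactly as in the crux decl) -/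

/-- Hard-sphere flows of `N + 1` spheres of reduced diameter `σ` on `𝕋³` (the crux's `Φ`). -/
abbrev Flow (σ : ℝ) (N : ℕ) : Type :=
  HardSphereFlow (Literature.Analysis.FluidPDE.Torus.geometry (Fin 3)) (hsDiameter σ N) (N + 1)

/-- Phase space of `N + 1` spheres on `𝕋³`. -/
abbrev Phase (N : ℕ) : Type := Config (N + 1) (Fin 3) T3

/-- The flow-invariant global Gibbs law `G_N` of the crux (constant profiles `a, u₀, θ`). -/
abbrev gibbs (σ a θ : ℝ) (u₀ : V3) (N : ℕ) (Φ : Flow σ N) : Measure (Phase N) :=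
  localGibbsLaw σ (fun _ => a) (fun _ => u₀) (fun _ => θ) N Φ

/-- The crux's cutoff shear stress `g_A(w) = ⟨e₁,w⟩⟨e₂,w⟩ (1 − smoothTransition (‖w‖²/A² − 1))`
(vanishes for `‖w‖ ≥ √2·A`, equals `⟨e₁,w⟩⟨e₂,w⟩` for `‖w‖ ≤ A`). -/
def cutoffStress (e₁ e₂ : V3) (A : ℝ) : V3 → ℝ :=
  fun w => inner ℝ e₁ w * inner ℝ e₂ w * (1 - Real.smoothTransition (‖w‖ ^ 2 / A ^ 2 - 1))

/-- Kinetic time unit `t₀ = ℓ/(σ²√θ)`, `ℓ = (N+1)^{-1/3}` (`= 4√π ≈ 7.09` mean free times; the unit of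
`BoltzmannGreenKubo`, stmt-13985), in macroscopic time. -/
def kineticUnit (σ θ : ℝ) (N : ℕ) : ℝ :=
  ((N + 1 : ℕ) : ℝ) ^ (-(1 / 3 : ℝ)) / (σ ^ 2 * Real.sqrt θ)

/-- The crux's window parameter `τ` for a window of `S` kinetic units: `τ = S/(σ²√θ)`, so that
`h = τ ℓ = S·t₀` (Disproof: `τ ≍ 1/(σ²√θ)` is necessary — `ShearStressHalfDrudeTauUniformInSigma` is false). -/
def kineticTau (S σ θ : ℝ) : ℝ :=
  S / (σ ^ 2 * Real.sqrt θ)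

/-- `W_N(τ; φ ⊗ g)`: the crux's windowed second moment (its left-hand side, verbatim), `h = τ (N+1)^{-1/3}`. -/
def windowSecondMoment (a θ : ℝ) (u₀ : V3) (σ : ℝ) (N : ℕ) (Φ : Flow σ N) (τ : ℝ) (φ : T3 → ℝ)
    (g : V3 → ℝ) : ℝ≥0∞ :=
  ∫⁻ z, ENNReal.ofReal (((τ * ((N + 1 : ℕ) : ℝ) ^ (-(1 / 3 : ℝ)))⁻¹ *
      ∫ s in (0 : ℝ)..(τ * ((N + 1 : ℕ) : ℝ) ^ (-(1 / 3 : ℝ))),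
        ∑ i, φ (Φ.flow s z i).1 * g ((Real.sqrt θ)⁻¹ • ((Φ.flow s z i).2 - u₀))) ^ 2) ∂(gibbs σ a θ u₀ N Φ)

/-- `Self_N(τ; φ ⊗ g) = Σᵢ ∫ (h⁻¹∫₀ʰ φ(xᵢ(s)) g(wᵢ(s)) ds)² dG_N`: the one-particle (`i = j`) part of `W_N`.
The DISTINCT part is, by definition, `W_N − Self_N` (so no splitting identity is needed downstream). -/
def selfSecondMoment (a θ : ℝ) (u₀ : V3) (σ : ℝ) (N : ℕ) (Φ : Flow σ N) (τ : ℝ) (φ : T3 → ℝ)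
    (g : V3 → ℝ) : ℝ≥0∞ :=
  ∑ i, ∫⁻ z, ENNReal.ofReal (((τ * ((N + 1 : ℕ) : ℝ) ^ (-(1 / 3 : ℝ)))⁻¹ *
      ∫ s in (0 : ℝ)..(τ * ((N + 1 : ℕ) : ℝ) ^ (-(1 / 3 : ℝ))),
        φ (Φ.flow s z i).1 * g ((Real.sqrt θ)⁻¹ • ((Φ.flow s z i).2 - u₀))) ^ 2) ∂(gibbs σ a θ u₀ N Φ)

/-- The static variance `V_N(φ ⊗ g) = (N+1)(∫φ²)(∫g² dγ)` (EXACT value of `∫F² dG_N` for centred `g`: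
refuter-verified `StaticShearVariance`; the crux's right-hand side is `½ V_N`). -/
def staticVariance (N : ℕ) (φ : T3 → ℝ) (g : V3 → ℝ) : ℝ :=
  (((N : ℝ)) + 1) * (∫ x, φ x ^ 2) * ∫ v, g v ^ 2 ∂(stdGaussian V3)

/-! ## Stub statements (named `Prop`s; the registered stubs are the `stub_*` theorems below) -/

/-- **Stub 1 — MASS-RELATIVE TAGGED DECAY** (size XL; the load-bearing bet of step (S); N-body, tagged).
In the crux's frame (kinetic unit `t₀ = kineticUnit σ θ N`): there is a rate `λ > 0` such that for every horizon `S`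
and tolerance `η` there is `σ₀(S, η)` with: for `σ < σ₀`, every CENTRED bounded continuous velocity observable `k`
(`∫k dγ = 0`, `|k| ≤ C`), all large `N`, every flow, every particle `i` and every `t ∈ [0, S]`,
`E_{G_N}[k(wᵢ(t·t₀)) k(wᵢ(0))] ≤ e^{−λt} ‖k‖²_{L²(γ)} + η · C · ‖k‖_{L¹(γ)}`.
The error is `sup × L¹` (MASS-RELATIVE), not `sup × sup` or `L² × L²`: this is what makes the self part
`A`-uniform at the slow end (`‖g_A‖_∞‖g_A‖₁ ≍ ‖g_A‖²₂ ≍ A⁷`). WHY PLAUSIBLE: the tilt `k(wᵢ(0))G_N` touches ONE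
velocity, which under `G_N` is independent of all positions and other velocities, so by linearity and sign-splitting
(`k = k⁺ − k⁻`, two PROBABILITY tilts of relative density `≤ C/m±`) it is a tagged-particle problem with an `L^∞`
datum, for which validity errors are maximum-principle/sup-norm and LINEAR in the relative density
(BGSR2016 Prop. 4.3 + 5.8; BLLS1980 for fixed test functions, all kinetic times), and the pairing with `k(wᵢ(t))`
costs `‖k‖_{L¹(γ)}`; the Boltzmann value `⟨k, e^{−tL_tag}k⟩_γ ≤ e^{−c₀ν(0)t}‖k‖²` by the PROVED tagged gap
(`TaggedSphereSpectralGap.exists_spectralGap`, energy-norm gap `c₀`, × `collisionFrequency_zero_pos`; only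
centring is needed — `Ker L_tag = constants`). WHY IT MIGHT FAIL: (i) N-uniformity at FIXED σ (N → ∞ first =
infinite volume at fixed mean free path; locality of the tagged pruning) is unprinted; (ii) the operator-norm
(`L^∞ → L^∞`, datum-independent pruning parameters) form of the tagged error is the card's falsifier (ii);
(iii) hydrodynamic `t^{-3/2}` tails have relative amplitude `O(σ⁶)` in `t₀` units — absorbed by `η` only because
`σ₀` follows `(S, η)` (this order is load-bearing). One-sided (upper) bound only: that is all stub 2 consumes. -/
def MassRelativeTaggedDecay : Prop :=
  ∀ (a θ : ℝ) (u₀ : V3), 0 < a → 0 < θ → ∃ lam : ℝ, 0 < lam ∧ ∀ (S η : ℝ), 0 < S → 0 < η →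
    ∃ σ₀ : ℝ, 0 < σ₀ ∧ ∀ σ : ℝ, 0 < σ → σ < σ₀ →
    ∀ k : V3 → ℝ, Continuous k → ∫ w, k w ∂(stdGaussian V3) = 0 → ∀ C : ℝ, (∀ w, |k w| ≤ C) →
    ∃ N₀ : ℕ, ∀ N : ℕ, N₀ ≤ N → ∀ (Φ : Flow σ N) (i : Fin (N + 1)) (t : ℝ), t ∈ Icc 0 S →
      ∫ z, k ((Real.sqrt θ)⁻¹ • ((Φ.flow (t * kineticUnit σ θ N) z i).2 - u₀)) *
          k ((Real.sqrt θ)⁻¹ • ((z i).2 - u₀)) ∂(gibbs σ a θ u₀ N Φ)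
        ≤ Real.exp (-(lam * t)) * (∫ w, k w ^ 2 ∂(stdGaussian V3))
          + η * C * ∫ w, |k w| ∂(stdGaussian V3)

/-- **SlowSelfDecay** (the OUTPUT of step (S), consumed by the composition; not itself a stub): for every
`η > 0` there is a horizon `S₀(η)` such that for `S ≥ S₀` and every cutoff ceiling `A₁` there is `σ₀(η, S, A₁)`
with: for `σ < σ₀`, all `e₁ ⊥ e₂`, ALL `A ∈ (0, A₁]`, all continuous `φ`, large `N` and every flow, the
self part of the window-`S t₀` second moment is at most `η` times the static variance —
UNIFORMLY IN `A → 0` (σ₀ depends on the ceiling `A₁`, never on `A`). -/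
def SlowSelfDecay : Prop :=
  ∀ (a θ : ℝ) (u₀ : V3), 0 < a → 0 < θ → ∀ η : ℝ, 0 < η → ∃ S₀ : ℝ, 0 < S₀ ∧ ∀ S : ℝ, S₀ ≤ S →
    ∀ A₁ : ℝ, 0 < A₁ → ∃ σ₀ : ℝ, 0 < σ₀ ∧ ∀ σ : ℝ, 0 < σ → σ < σ₀ →
    ∀ (e₁ e₂ : V3), inner ℝ e₁ e₂ = 0 → ∀ A : ℝ, 0 < A → A ≤ A₁ → ∀ φ : T3 → ℝ, Continuous φ →
    ∃ N₀ : ℕ, ∀ N : ℕ, N₀ ≤ N → ∀ Φ : Flow σ N,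
      selfSecondMoment a θ u₀ σ N Φ (kineticTau S σ θ) φ (cutoffStress e₁ e₂ A)
        ≤ ENNReal.ofReal (η * staticVariance N φ (cutoffStress e₁ e₂ A))

/-- **Stub 2 — SELF-PART REDUCTION** (size L; exact identities + one equilibrium limit; provable modulo the
mild inputs named): `MassRelativeTaggedDecay → SlowSelfDecay`. Proof plan: (a) per particle,
`E[(h⁻¹∫₀ʰ aᵢ)²] = 2h⁻²∫₀ʰ (h−t) Cᵢ(t) dt`, `Cᵢ(t) = E[aᵢ(t)aᵢ(0)]`, `aᵢ = φ(xᵢ)g_A(wᵢ)` (Fubini on the good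
set + stationarity `HomogeneousInvariance` stmt-9621, as in Disproof's `WO.integral_window_eq`); only an UPPER bound
on `Cᵢ` is used (weight `h − t ≥ 0`). (b) φ-FREEZING and factorisation: `|xᵢ(t) − xᵢ(0)| = O(S t₀ |v|) → 0`
macroscopically, so `Cᵢ(t) = E[φ(xᵢ(0))² g_A(wᵢ(t))g_A(wᵢ(0))] + err`, and by torus translation invariance of
`G_N` and translation covariance of the dynamics (a.e.-uniqueness of hard-sphere trajectories, `HardSphereAlexander`)
`xᵢ(0)` is independent of the process `(wᵢ(s))ₛ`, whence the first term is EXACTLY `(∫φ²)·E[g_A(wᵢ(t))g_A(wᵢ(0))]`;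
`err ≤ ‖φ‖_∞‖g_A‖_∞[ω_φ(δ) + 2‖φ‖_∞ sup_{|w|≤√2A₁} P(displacement > δ | wᵢ(0) = w)]‖g_A‖_{L¹(γ)}` with the
conditional displacement probability → 0 as `N → ∞` (wᵢ(0) ⊥ rest; equilibrium collision-rate/Campbell bound),
so `err ≤ (η/3)(∫φ²)‖g_A‖²_γ` for `N ≥ N₀(φ, …)` (if `∫φ² = 0` then `φ ≡ 0` and all is `0`). (c) apply stub 1 with
`k = g_A` (centred by the `e₁`-reflection, `|g_A| ≤ 2A²‖e₁‖‖e₂‖`) and the Gaussian ratio bound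
`‖g_A‖_∞‖g_A‖_{L¹(γ)} ≤ K(A₁)‖g_A‖²_{L²(γ)}` on `(0, A₁]` (scale-free in `‖eᵢ‖`; `≍ A²·A⁵/A⁷` at `0`): window
fraction `≤ 2/(λS) + K(A₁)η' + η/3`; choose `S₀ = 6/(λη)`, `η' = η/(3K(A₁))` (so `σ₀ = σ₀^{stub 1}(S, η')` depends on
`A₁` — exactly the quantifier order of `SlowSelfDecay`). Leans on: `integral_comp_flow_localGibbsLaw_const`,
`HardSphereFlow.measurable_flow_prod_torus`, `localGibbsLaw` product structure (`lintegral_localGibbsMeasure`). -/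
def SelfPartReduction : Prop :=
  MassRelativeTaggedDecay → SlowSelfDecay

/-- **Stub 3 — SLOW-CUTOFF DISTINCT PART VANISHES** (size L; the card's `SlowCutoffDistinctVanishes`, stated as
consumed: one-sided, relative to the static variance, `A₀(η, S)` chosen BEFORE `σ` and `φ`). For every `η, S > 0`
there are an ABSOLUTE hand-off cutoff `A₀` and `σ₀` such that for `σ < σ₀`, `e₁ ⊥ e₂`, ALL `A ≤ A₀`, continuous
`φ`, large `N` and every flow: `W_N(S t₀) ≤ Self_N(S t₀) + η V_N`. Proof plan: (a) expand the square:
`W − Self = Σ_{i≠j} E[XᵢXⱼ]`, `Xᵢ` = window average of `aᵢ`; two-time covariances `E[aᵢ(t)aⱼ(0)]`, `i ≠ j`.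
(b) RESAMPLING IDENTITY (exact; = ideator 2's `ResamplingOrthogonality`): `E[aᵢ(t)aⱼ(0)] = E[aⱼ(0)(aᵢ(t) − aᵢ^{(j′)}(t))]`,
`wⱼ(0)` replaced by an independent Gaussian copy — because `E_γ g_A = 0` and `wⱼ(0) ⊥ everything else` under `G_N`;
the difference vanishes unless `j ∈ BC_i(t) ∪ BC′_i(t)` (backward clusters, `BackwardCluster.lean`). (c) TWO slowness
indicators against ONE membership event: `|aⱼ(0)| ≤ ‖φ‖_∞A²·1_B(wⱼ(0))`, `|aᵢ(t) − aᵢ′(t)| ≤ ‖φ‖_∞A²[1_B(wᵢ(t)) + 1_B(wᵢ′(t))]`,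
`B = B_{√2A}`, `γ(B) ≍ A³`; the primed-world term carries `γ(B)` EXACTLY (independence), the unprimed one by
domination of the slowness-conditioned law; worst geometry (thermal `i` stopped dead by a head-on hit on slow `j`,
solid angle `≍ A²`) gives `Σⱼ|E[aᵢ(t)aⱼ(0)]| ≤ C(S)‖φ‖²_∞ A⁹` against `‖g_A‖²_γ ≍ A⁷`. (d) φ-REMOVAL (F4 of the
ideator's negative notes): members of `BC_i(S t₀)` are macroscopically co-located with `i` as `N → ∞`, so `φ` enters
as `∫φ²` up to `o_N(1)` (this is where `N₀` depends on `φ`), and `A₀² C(S) ≤ cη` is `φ`- and `σ`-free.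
INPUT (shared, first-moment): `E|BC_i(S t₀)| ≤ C(S)` uniformly in `N` at fixed `σ ≤ σ₀`, `C(S)` σ-free in `t₀`
units (`nπd²v̄·S t₀ = O(S)`: the σ's cancel) — triage's `TaggedClusterSizeBound` / route item InfluenceLocality
(13916) in first-moment form; Campbell/stationarity under `G_N`, no validity theorem. WHY IT MIGHT FAIL: a
conspiracy between slowness and cluster membership beyond the head-on `A²` (none found), or failure of the
N-uniform first-moment cluster bound at fixed σ (Maxwellian tails of far fast particles). -/
def SlowDistinctVanishes : Prop :=
  ∀ (a θ : ℝ) (u₀ : V3), 0 < a → 0 < θ → ∀ (η S : ℝ), 0 < η → 0 < S →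
    ∃ A₀ : ℝ, 0 < A₀ ∧ ∃ σ₀ : ℝ, 0 < σ₀ ∧ ∀ σ : ℝ, 0 < σ → σ < σ₀ →
    ∀ (e₁ e₂ : V3), inner ℝ e₁ e₂ = 0 → ∀ A : ℝ, 0 < A → A ≤ A₀ → ∀ φ : T3 → ℝ, Continuous φ →
    ∃ N₀ : ℕ, ∀ N : ℕ, N₀ ≤ N → ∀ Φ : Flow σ N,
      windowSecondMoment a θ u₀ σ N Φ (kineticTau S σ θ) φ (cutoffStress e₁ e₂ A)
        ≤ selfSecondMoment a θ u₀ σ N Φ (kineticTau S σ θ) φ (cutoffStress e₁ e₂ A)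
          + ENNReal.ofReal (η * staticVariance N φ (cutoffStress e₁ e₂ A))

/-- **Stub 4 — DRUDE FRACTION ON CUTOFF COMPACTS** (size XL; DELEGATED — it is the whole target of the companion
lines, here in its weakest sufficient OUTPUT form). For every tolerance `r > 0` and every cutoff compact
`[A₀, A₁] ⊂ (0, ∞)` there is `σ₀(r, A₀, A₁)` with: for `σ < σ₀`, `e₁ ⊥ e₂`, `A ∈ [A₀, A₁]`, continuous `φ`,
SOME window `τ` and `N₀`: `W_N(τ) ≤ r V_N` for `N ≥ N₀` and every flow. `σ₀` AFTER `r` = the dilute-corner order of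
`BoltzmannGreenKubo` (stmt-13985): by triage F1 (r1-3) this is `13985|_{φ≡1, finite 0.1-net of the precompact family
{ĝ_{ê₁,ê₂,A} : A ∈ [A₀,A₁]}}` + `NetLipschitz` (= stub 5) + `FrozenModulation`, OR the companion card's
`FixedDensityEnvelope` on `[A₀, A₁]` + `WindowBudget` (`r = 2/(λS) + η`). Differs from the crux restricted to
`[A₀, A₁]` in two ways: smaller budget (slack is free at long windows: `r_B(x) ≤ 2/x`, Disproof
`windowFraction_le_two_div`) and `σ₀` depending on the compact (sup/`L²` ratio `≍ A₀^{-3/2}`, `A₁²`). WHY IT MIGHT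
FAIL: N → ∞ FIRST at fixed σ (locality of BGSS's pruning / `L²`-duality bounds; unprinted), exactly 13985's open
point; false iff a uniform-in-N Drude weight of the cutoff stress survives in the dilute corner (MazurBoundBallistic:
a hidden extensive symmetric-traceless charge). Sources: BGSSCPAM2023 Thm 1.1, BodineauEtAl2024 Thm 1.2,
VanbeijerenEtAl1980, 13985. IMPLIED BY the companion skeleton's `EnvelopeAwayFromRest` (on `[A₀, ∞)`) +
`WindowBudget` + `StaticShearVariance` with `S := 4/(λr)`, `η := r/2`, `τ := S/(σ²√θ)` — i.e. by its stubs
`stub_singleObservableEnvelope` (OPEN) + `stub_cutoffCompactification` + `stub_windowBudget` + `stub_staticShearVariance`. -/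
def CompactCutoffDrude : Prop :=
  ∀ (a θ : ℝ) (u₀ : V3), 0 < a → 0 < θ → ∀ r : ℝ, 0 < r → ∀ A₀ A₁ : ℝ, 0 < A₀ → A₀ ≤ A₁ →
    ∃ σ₀ : ℝ, 0 < σ₀ ∧ ∀ σ : ℝ, 0 < σ → σ < σ₀ →
    ∀ (e₁ e₂ : V3), inner ℝ e₁ e₂ = 0 → ∀ A : ℝ, A₀ ≤ A → A ≤ A₁ → ∀ φ : T3 → ℝ, Continuous φ →
    ∃ τ : ℝ, 0 < τ ∧ ∃ N₀ : ℕ, ∀ N : ℕ, N₀ ≤ N → ∀ Φ : Flow σ N,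
      windowSecondMoment a θ u₀ σ N Φ τ φ (cutoffStress e₁ e₂ A)
        ≤ ENNReal.ofReal (r * staticVariance N φ (cutoffStress e₁ e₂ A))

/-- **Stub 5 — CUTOFF CONTINUITY** (size M; TRUE, provable now; the card's first lemma `CutoffContinuity` =
ideator 2's `NetLipschitz`, one-sided `ℝ≥0∞` form). For `σ ≤ ½` (so `G_N` is a probability measure), every `N`,
flow, window `τ > 0`, continuous `φ` and CENTRED bounded continuous `g, g'`:
`W_N(τ; φ⊗g) ≤ W_N(τ; φ⊗g') + (N+1)(∫φ²)(‖g‖_γ + ‖g'‖_γ)‖g − g'‖_γ`. Proof: `W = ‖𝒜F‖²_{L²(G_N)}` with the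
window average `𝒜` a CONTRACTION of `L²(G_N)` (Jensen in `s` + invariance of `G_N` under each `Φ_s`, item 9621),
`|‖𝒜F‖² − ‖𝒜F'‖²| ≤ ‖𝒜(F − F')‖(‖𝒜F‖ + ‖𝒜F'‖) ≤ ‖F − F'‖(‖F‖ + ‖F'‖)`, and the EXACT static identity
`‖Σᵢ φ(xᵢ)k(wᵢ)‖²_{L²(G_N)} = (N+1)(∫φ²)‖k‖²_γ` for centred `k` (i.i.d. Gaussian velocities independent of the
translation-invariant positions; `StaticShearVariance`); `W < ∞` for bounded `g` so nothing is junk. Mean-zero is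
essential (Disproof `WO`: without it cross terms are `O(N²)`). -/
def CutoffContinuity : Prop :=
  ∀ (a θ : ℝ) (u₀ : V3), 0 < a → 0 < θ → ∀ σ : ℝ, 0 < σ → σ ≤ 1 / 2 →
    ∀ (N : ℕ) (Φ : Flow σ N) (τ : ℝ), 0 < τ → ∀ φ : T3 → ℝ, Continuous φ →
    ∀ g g' : V3 → ℝ, Continuous g → Continuous g' →
    (∃ C : ℝ, ∀ w, |g w| ≤ C) → (∃ C : ℝ, ∀ w, |g' w| ≤ C) →
    ∫ w, g w ∂(stdGaussian V3) = 0 → ∫ w, g' w ∂(stdGaussian V3) = 0 →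
      windowSecondMoment a θ u₀ σ N Φ τ φ g
        ≤ windowSecondMoment a θ u₀ σ N Φ τ φ g'
          + ENNReal.ofReal ((((N : ℝ)) + 1) * (∫ x, φ x ^ 2) *
              ((Real.sqrt (∫ w, g w ^ 2 ∂(stdGaussian V3)) + Real.sqrt (∫ w, g' w ^ 2 ∂(stdGaussian V3))) *
                Real.sqrt (∫ w, (g w - g' w) ^ 2 ∂(stdGaussian V3))))

/-- **Stub 6 — GAUSSIAN FACTS OF THE CUTOFF FAMILY** (size M; TRUE, provable now; pure Gaussian analysis on
`V3 = ℝ³`, no dynamics). (i) For every `e₁, e₂, A > 0`: `g_A` is continuous, `|g_A| ≤ 2A²‖e₁‖‖e₂‖`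
(`smoothTransition = 1` on `[1, ∞)` kills `‖w‖² ≥ 2A²`), and for `e₁ ⊥ e₂` it is CENTRED (`∫g_A dγ = 0`: the
reflection `w ↦ w − 2⟨ê₁,w⟩ê₁` preserves `γ` and `‖w‖` and flips the sign) with `‖g_A‖²_γ ≤ ‖e₁‖²‖e₂‖²`
(`0 ≤ cutoff ≤ 1` and Isserlis: `E[⟨e₁,w⟩²⟨e₂,w⟩²] = ‖e₁‖²‖e₂‖² + 2⟨e₁,e₂⟩²`). (ii) `L²(γ)`-CAUCHY AT INFINITY
with explicit norms: for every `ε > 0` there is `A⋆` such that for `A, A' ≥ A⋆` and `e₁ ⊥ e₂`,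
`‖g_A − g_{A'}‖²_γ ≤ ε²‖e₁‖²‖e₂‖²` and `(1 − ε)‖e₁‖²‖e₂‖² ≤ ‖g_A‖²_γ` (both from
`|g_A − g_{A'}|, |⟨e₁,w⟩⟨e₂,w⟩ − g_A| ≤ |⟨e₁,w⟩⟨e₂,w⟩|·1_{‖w‖ > min(A,A')}` and the tail
`E[‖w‖⁴; ‖w‖ > A⋆] → 0` of the standard Gaussian on `ℝ³`). This is the compactness half of the card's step (C):
it turns the slack `½ − r` at one large cutoff into the crux for all larger cutoffs. -/
def CutoffGaussianTail : Prop :=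
  (∀ (e₁ e₂ : V3) (A : ℝ), 0 < A →
      Continuous (cutoffStress e₁ e₂ A) ∧
      (∀ w, |cutoffStress e₁ e₂ A w| ≤ 2 * A ^ 2 * ‖e₁‖ * ‖e₂‖) ∧
      (inner ℝ e₁ e₂ = 0 → ∫ w, cutoffStress e₁ e₂ A w ∂(stdGaussian V3) = 0) ∧
      (inner ℝ e₁ e₂ = 0 →
        ∫ w, cutoffStress e₁ e₂ A w ^ 2 ∂(stdGaussian V3) ≤ ‖e₁‖ ^ 2 * ‖e₂‖ ^ 2)) ∧
  ∀ ε : ℝ, 0 < ε → ∃ Astar : ℝ, 0 < Astar ∧ ∀ A A' : ℝ, Astar ≤ A → Astar ≤ A' →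
    ∀ (e₁ e₂ : V3), inner ℝ e₁ e₂ = 0 →
      ∫ w, (cutoffStress e₁ e₂ A w - cutoffStress e₁ e₂ A' w) ^ 2 ∂(stdGaussian V3)
          ≤ ε ^ 2 * (‖e₁‖ ^ 2 * ‖e₂‖ ^ 2) ∧
      (1 - ε) * (‖e₁‖ ^ 2 * ‖e₂‖ ^ 2) ≤ ∫ w, cutoffStress e₁ e₂ A w ^ 2 ∂(stdGaussian V3)

/-! ## Registered stubs -/

/-- STUB 1 (XL; OPEN — the line's own bet, HARDEST proper stub). Sources: VanbeijerenEtAl1980 (tagged equilibrium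
time correlations → linear Boltzmann, all kinetic times, Boltzmann–Grad); BodineauGallagherSaintRaymondInvent2016
Thm 2.2, Prop. 4.3 + 5.8 (sup-norm tagged validity, constants in `‖ρ⁰‖_∞`), Lemma 6.1 (tree:
`TaggedSphereSpectralGap.exists_spectralGap`, PROVED; `TaggedSphereCollisionFrequency.collisionFrequency_zero_pos`,
PROVED); BGSSCPAM2023 pp. 15–16 (why the collective engine pays `sup × L²`). Tree vocabulary for the proof:
`PseudoTrajectoryCoupling`, `TaggedBoltzmannPruning`, `RecollisionGeometry` (`bgsr_lemma52_*`, PROVED),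
`bgsr_linearBoltzmannApprox_of_inputs` (the BG-limit chain; the fixed-σ, N-uniform, `L^∞ → L^∞` version is the bet). -/
theorem stub_massRelativeTaggedDecay : MassRelativeTaggedDecay := by
  sorry

/-- STUB 2 (L; exact identities + equilibrium displacement bound; provable now modulo translation covariance of
the flow version). Sources: Disproof.lean `WO.integral_window_eq` (Fubini + stationarity template); route items
HomogeneousInvariance (stmt-9621), StaticShearVariance (companion card); `HardSphereAlexander` (a.e. uniqueness). -/
theorem stub_selfPartReduction : SelfPartReduction := by
  sorry

/-- STUB 3 (L; exact resampling identity + two slowness factors + N-uniform FIRST-MOMENT backward-cluster bound at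
fixed σ). Sources: Efron–Stein 1981 (resampling, used as an exact identity); PulvirentiSimonella2021 Thm 2.1 /
AokiEtAl2015 Thm 3.1 (backward-cluster cardinality); tree `BackwardCluster`/`BackwardClusterMeasurable`
(`backwardCluster`, `meanBackwardClusterCard`); route item InfluenceLocality (stmt-13916, first-moment form);
triage r1-2 sharpening (only a first-moment forward/backward-cluster bound is consumed). -/
theorem stub_slowDistinctVanishes : SlowDistinctVanishes := by
  sorry

/-- STUB 4 (XL; OPEN, DELEGATED — target of lines `fixed-budget-signed-hierarchy` / `cutoff-compactness-net`; do
not staff twice: it is `BoltzmannGreenKubo` (stmt-13985)|net + `FrozenModulation` by triage F1). Sources: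
BGSSCPAM2023 Thm 1.1 (arXiv:2012.03813 p. 4), BodineauEtAl2024 Thm 1.2 (arXiv:2201.04514 p. 5),
VanbeijerenEtAl1980, BarangerMouhot2005 (gap; tree `le_neg_maxwellianInner_hardSphereLinearizedOp_of_orthogonal_holds`,
PROVED), Disproof `windowFraction_le_two_div`. -/
theorem stub_compactCutoffDrude : CompactCutoffDrude := by
  sorry

/-- STUB 5 (M; TRUE, provable now — refuter-verified on paper three times in triage). Sources: Jensen + invariance
(item 9621); `StaticShearVariance`; Mathlib `MeasureTheory.MemLp`, `eLpNorm` triangle inequality. -/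
theorem stub_cutoffContinuity : CutoffContinuity := by
  sorry

/-- STUB 6 (M; TRUE, provable now — Gaussian integrals on `EuclideanSpace ℝ (Fin 3)`). Sources: Mathlib
`ProbabilityTheory.stdGaussian`, `Real.smoothTransition` API (`zero_of_nonpos`, `one_of_one_le`, `le_one`,
`nonneg`), Disproof.lean `gW_eq_zero_of_two_le` / `WO.gS_le_four` (templates for the support and sup bounds),
Isserlis/Wick for a centred Gaussian pair. -/
theorem stub_cutoffGaussianTail : CutoffGaussianTail := by
  sorry

/-! ## Landed negative lemmas this skeleton is checked against (imported above; no stub is an instance) -/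

/-- `Theorems/ShearStressHalfDrude/Negative/FalseForAllN`: the `∀ N` strengthening of the crux is FALSE (one free sphere).
Honoured: every collisional stub (1, 3, 4) carries `∃ N₀`, and stubs 5–6 are collision-free exact statements that claim
no decay. -/
example : ¬ Literature.Uncategorized.ShearStressHalfDrudeAllN :=
  Summit.AtomisticToContinuum.HydrodynamicLimit.Theorems.ShearStressHalfDrudeOneSphere.not_shearStressHalfDrudeAllN

/-- `Theorems/ShearStressHalfDrude/Negative/WithoutOrth`: the crux without `e₁ ⊥ e₂` is FALSE (centring load-bearing).
Honoured: stub 1 assumes `∫k dγ = 0`, stub 5 is stated for centred `g, g'`, stub 6 derives `∫g_A dγ = 0` from `e₁ ⊥ e₂`,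
and stubs 2–4 carry `inner ℝ e₁ e₂ = 0` as a hypothesis. -/
example : ¬ Summit.AtomisticToContinuum.HydrodynamicLimit.Theorems.ShearStressHalfDrudeWithoutOrth :=
  Summit.AtomisticToContinuum.HydrodynamicLimit.Theorems.ShearStressHalfDrudeNonCentred.shearStressHalfDrudeWithoutOrth_false

/-! ## Composition (sorry-free) -/

/-- The static variance is nonnegative. -/
theorem staticVariance_nonneg (N : ℕ) (φ : T3 → ℝ) (g : V3 → ℝ) : 0 ≤ staticVariance N φ g := by
  unfold staticVariance
  have h1 : 0 ≤ ∫ x, φ x ^ 2 := integral_nonneg fun _ => sq_nonneg _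
  have h2 : 0 ≤ ∫ v, g v ^ 2 ∂(stdGaussian V3) := integral_nonneg fun _ => sq_nonneg _
  positivity

/-- Re-association of the budget: `r · V_N` in the crux's spelling. -/
theorem budget_eq (r : ℝ) (N : ℕ) (φ : T3 → ℝ) (g : V3 → ℝ) :
    r * (((N : ℝ)) + 1) * (∫ x, φ x ^ 2) * ∫ v, g v ^ 2 ∂(stdGaussian V3) = r * staticVariance N φ g := by
  unfold staticVariance; ring

/-- The kinetic window parameter is positive. -/
theorem kineticTau_pos {S σ θ : ℝ} (hS : 0 < S) (hσ : 0 < σ) (hθ : 0 < θ) : 0 < kineticTau S σ θ := by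
  unfold kineticTau
  exact div_pos hS (mul_pos (pow_pos hσ 2) (Real.sqrt_pos.2 hθ))

/-- **Composition of the line** (proved; quantifier merging + the three-regime case split in `A`).
Constants: `η = r = ε = 1/8`. The body is the crux decl spelled with the reducible frame abbreviations. -/
theorem shearStressHalfDrude_of_parts (h₁ : MassRelativeTaggedDecay) (h₂ : SelfPartReduction)
    (h₃ : SlowDistinctVanishes) (h₄ : CompactCutoffDrude) (h₅ : CutoffContinuity)
    (h₆ : CutoffGaussianTail) :
    ∀ (a θ : ℝ) (u₀ : V3), 0 < a → 0 < θ → ∃ σ₀ : ℝ, 0 < σ₀ ∧ ∀ σ : ℝ, 0 < σ → σ < σ₀ →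
      (∀ (N : ℕ) (Φ : Flow σ N), IsProbabilityMeasure (gibbs σ a θ u₀ N Φ)) ∧
      ∀ (e₁ e₂ : V3), inner ℝ e₁ e₂ = 0 → ∀ A : ℝ, 0 < A → ∀ g : V3 → ℝ,
        (g = fun w => inner ℝ e₁ w * inner ℝ e₂ w * (1 - Real.smoothTransition (‖w‖ ^ 2 / A ^ 2 - 1))) →
        ∀ φ : T3 → ℝ, Continuous φ → ∃ τ : ℝ, 0 < τ ∧ ∃ N₀ : ℕ, ∀ N : ℕ, N₀ ≤ N → ∀ Φ : Flow σ N,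
          windowSecondMoment a θ u₀ σ N Φ τ φ g
            ≤ ENNReal.ofReal ((1 / 2) * (((N : ℝ)) + 1) * (∫ x, φ x ^ 2) *
                ∫ v, g v ^ 2 ∂(stdGaussian V3)) := by
  intro a θ u₀ ha hθ
  -- slow end: self part at tolerance 1/8 fixes the horizon S₀; distinct part fixes the hand-off cutoff A₀
  obtain ⟨S₀, hS₀, hself⟩ := h₂ h₁ a θ u₀ ha hθ (1 / 8) (by norm_num)
  obtain ⟨A₀, hA₀, σ₃, hσ₃, hdist⟩ := h₃ a θ u₀ ha hθ (1 / 8) S₀ (by norm_num) hS₀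
  obtain ⟨σ₂, hσ₂, hselfA⟩ := hself S₀ le_rfl A₀ hA₀
  -- upper tail: Gaussian facts at ε = 1/8 fix A⋆; the compact regime is [A₀, A₁], A₁ = max A₀ A⋆
  obtain ⟨hfacts, htail⟩ := h₆
  obtain ⟨Astar, hAstar, htail'⟩ := htail (1 / 8) (by norm_num)
  obtain ⟨A₁, hA₀A₁, hAstarA₁, hA₁pos⟩ : ∃ A₁ : ℝ, A₀ ≤ A₁ ∧ Astar ≤ A₁ ∧ 0 < A₁ :=
    ⟨max A₀ Astar, le_max_left _ _, le_max_right _ _, lt_of_lt_of_le hA₀ (le_max_left _ _)⟩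
  obtain ⟨σ₁, hσ₁, heng⟩ := h₄ a θ u₀ ha hθ (1 / 8) (by norm_num) A₀ A₁ hA₀ hA₀A₁
  refine ⟨min (min σ₁ σ₂) (min σ₃ (1 / 2)),
    lt_min (lt_min hσ₁ hσ₂) (lt_min hσ₃ (by norm_num)), fun σ hσ hσlt => ?_⟩
  have hσ₁' : σ < σ₁ := lt_of_lt_of_le hσlt ((min_le_left _ _).trans (min_le_left _ _))
  have hσ₂' : σ < σ₂ := lt_of_lt_of_le hσlt ((min_le_left _ _).trans (min_le_right _ _))
  have hσ₃' : σ < σ₃ := lt_of_lt_of_le hσlt ((min_le_right _ _).trans (min_le_left _ _))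
  have hσhalf : σ ≤ 1 / 2 := (lt_of_lt_of_le hσlt ((min_le_right _ _).trans (min_le_right _ _))).le
  have hP : ∀ (N : ℕ) (Φ : Flow σ N), IsProbabilityMeasure (gibbs σ a θ u₀ N Φ) := fun N Φ =>
    Literature.MathematicalPhysics.KineticTheory.isProbabilityMeasure_localGibbsLaw
      continuous_const continuous_const continuous_const (fun _ => ha) (fun _ => hθ) hσhalf N Φ
  refine ⟨hP, fun e₁ e₂ he A hA g hg φ hφ => ?_⟩
  -- the crux's `g` is the cutoff stress
  have hg' : g = cutoffStress e₁ e₂ A := hg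
  subst hg'
  have hVnn : ∀ (N : ℕ) (A' : ℝ), 0 ≤ staticVariance N φ (cutoffStress e₁ e₂ A') := fun N A' =>
    staticVariance_nonneg N φ _
  rcases le_or_gt A A₀ with hAle | hAgt
  · -- REGIME 1 (slow end, A ≤ A₀): W ≤ Self + V/8 ≤ V/8 + V/8 ≤ V/2
    obtain ⟨N₂, hN₂⟩ := hselfA σ hσ hσ₂' e₁ e₂ he A hA hAle φ hφ
    obtain ⟨N₃, hN₃⟩ := hdist σ hσ hσ₃' e₁ e₂ he A hA hAle φ hφ
    refine ⟨kineticTau S₀ σ θ, kineticTau_pos hS₀ hσ hθ, max N₂ N₃, fun N hN Φ => ?_⟩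
    have h1 := hN₃ N ((le_max_right _ _).trans hN) Φ
    have h2 := hN₂ N ((le_max_left _ _).trans hN) Φ
    have hV := hVnn N A
    calc windowSecondMoment a θ u₀ σ N Φ (kineticTau S₀ σ θ) φ (cutoffStress e₁ e₂ A)
        ≤ selfSecondMoment a θ u₀ σ N Φ (kineticTau S₀ σ θ) φ (cutoffStress e₁ e₂ A)
            + ENNReal.ofReal (1 / 8 * staticVariance N φ (cutoffStress e₁ e₂ A)) := h1
      _ ≤ ENNReal.ofReal (1 / 8 * staticVariance N φ (cutoffStress e₁ e₂ A))
            + ENNReal.ofReal (1 / 8 * staticVariance N φ (cutoffStress e₁ e₂ A)) :=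
          add_le_add h2 le_rfl
      _ = ENNReal.ofReal (1 / 8 * staticVariance N φ (cutoffStress e₁ e₂ A)
            + 1 / 8 * staticVariance N φ (cutoffStress e₁ e₂ A)) :=
          (ENNReal.ofReal_add (mul_nonneg (by norm_num) hV) (mul_nonneg (by norm_num) hV)).symm
      _ ≤ ENNReal.ofReal ((1 / 2) * staticVariance N φ (cutoffStress e₁ e₂ A)) :=
          ENNReal.ofReal_le_ofReal (by nlinarith)
      _ = _ := by rw [budget_eq]
  · rcases le_or_gt A A₁ with hAle₁ | hAgt₁
    · -- REGIME 2 (compact, A₀ ≤ A ≤ A₁): the engine at budget 1/8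
      obtain ⟨τ, hτ, N₀, hN₀⟩ := heng σ hσ hσ₁' e₁ e₂ he A hAgt.le hAle₁ φ hφ
      refine ⟨τ, hτ, N₀, fun N hN Φ => (hN₀ N hN Φ).trans ?_⟩
      have hV := hVnn N A
      rw [budget_eq]
      exact ENNReal.ofReal_le_ofReal (by nlinarith)
    · -- REGIME 3 (upper tail, A ≥ A₁): engine at A₁, continuity, Gaussian tail
      obtain ⟨τ, hτ, N₀, hN₀⟩ := heng σ hσ hσ₁' e₁ e₂ he A₁ hA₀A₁ le_rfl φ hφ
      refine ⟨τ, hτ, N₀, fun N hN Φ => ?_⟩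
      rw [budget_eq]
      obtain ⟨hcA, hbA, hzA, hnA⟩ := hfacts e₁ e₂ A hA
      obtain ⟨hcA₁, hbA₁, hzA₁, hnA₁⟩ := hfacts e₁ e₂ A₁ hA₁pos
      have hAstarA : Astar ≤ A := hAstarA₁.trans hAgt₁.le
      obtain ⟨hd, hlow⟩ := htail' A A₁ hAstarA hAstarA₁ e₁ e₂ he
      have hcont := h₅ a θ u₀ ha hθ σ hσ hσhalf N Φ τ hτ φ hφ (cutoffStress e₁ e₂ A)
        (cutoffStress e₁ e₂ A₁) hcA hcA₁ ⟨_, hbA⟩ ⟨_, hbA₁⟩ (hzA he) (hzA₁ he)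
      have heng₁ := hN₀ N hN Φ
      -- abbreviations for the real arithmetic
      set E : ℝ := ‖e₁‖ ^ 2 * ‖e₂‖ ^ 2 with hEdef
      set n : ℝ := ∫ w, cutoffStress e₁ e₂ A w ^ 2 ∂(stdGaussian V3) with hndef
      set n₁ : ℝ := ∫ w, cutoffStress e₁ e₂ A₁ w ^ 2 ∂(stdGaussian V3) with hn₁def
      set d : ℝ := ∫ w, (cutoffStress e₁ e₂ A w - cutoffStress e₁ e₂ A₁ w) ^ 2 ∂(stdGaussian V3)
        with hddef
      set K : ℝ := (((N : ℝ)) + 1) * ∫ x, φ x ^ 2 with hKdef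
      have hE : 0 ≤ E := by rw [hEdef]; positivity
      have hφ2 : 0 ≤ ∫ x, φ x ^ 2 := integral_nonneg fun _ => sq_nonneg _
      have hK : 0 ≤ K := by rw [hKdef]; exact mul_nonneg (by positivity) hφ2
      have hn : 0 ≤ n := by rw [hndef]; exact integral_nonneg fun _ => sq_nonneg _
      have hn₁ : 0 ≤ n₁ := by rw [hn₁def]; exact integral_nonneg fun _ => sq_nonneg _
      have hdnn : 0 ≤ d := by rw [hddef]; exact integral_nonneg fun _ => sq_nonneg _
      have hnE : n ≤ E := hnA he
      have hn₁E : n₁ ≤ E := hnA₁ he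
      have hsd : Real.sqrt d ≤ 1 / 8 * Real.sqrt E := by
        calc Real.sqrt d ≤ Real.sqrt ((1 / 8) ^ 2 * E) := Real.sqrt_le_sqrt hd
          _ = 1 / 8 * Real.sqrt E := by
              rw [Real.sqrt_mul (by positivity), Real.sqrt_sq (by norm_num)]
      have hsn : Real.sqrt n ≤ Real.sqrt E := Real.sqrt_le_sqrt hnE
      have hsn₁ : Real.sqrt n₁ ≤ Real.sqrt E := Real.sqrt_le_sqrt hn₁E
      have hEE : Real.sqrt E * Real.sqrt E = E := Real.mul_self_sqrt hE
      have hprod : (Real.sqrt n + Real.sqrt n₁) * Real.sqrt d ≤ 1 / 4 * E := by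
        calc (Real.sqrt n + Real.sqrt n₁) * Real.sqrt d
            ≤ (Real.sqrt E + Real.sqrt E) * (1 / 8 * Real.sqrt E) :=
              mul_le_mul (add_le_add hsn hsn₁) hsd (Real.sqrt_nonneg _) (by positivity)
          _ = 1 / 4 * (Real.sqrt E * Real.sqrt E) := by ring
          _ = 1 / 4 * E := by rw [hEE]
      have hprod_nn : 0 ≤ (Real.sqrt n + Real.sqrt n₁) * Real.sqrt d := by positivity
      have hKprod : K * ((Real.sqrt n + Real.sqrt n₁) * Real.sqrt d) ≤ K * (1 / 4 * E) :=
        mul_le_mul_of_nonneg_left hprod hK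
      have hKn₁ : K * n₁ ≤ K * E := mul_le_mul_of_nonneg_left hn₁E hK
      have hKlow : K * ((1 - 1 / 8) * E) ≤ K * n := mul_le_mul_of_nonneg_left hlow hK
      have hreal : 1 / 8 * staticVariance N φ (cutoffStress e₁ e₂ A₁)
          + K * ((Real.sqrt n + Real.sqrt n₁) * Real.sqrt d)
            ≤ (1 / 2) * staticVariance N φ (cutoffStress e₁ e₂ A) := by
        have hV₁ : staticVariance N φ (cutoffStress e₁ e₂ A₁) = K * n₁ := by
          rw [hKdef, hn₁def]; rfl
        have hV : staticVariance N φ (cutoffStress e₁ e₂ A) = K * n := by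
          rw [hKdef, hndef]; rfl
        rw [hV₁, hV]
        nlinarith [mul_nonneg hK hE, hKprod, hKn₁, hKlow]
      calc windowSecondMoment a θ u₀ σ N Φ τ φ (cutoffStress e₁ e₂ A)
          ≤ windowSecondMoment a θ u₀ σ N Φ τ φ (cutoffStress e₁ e₂ A₁)
              + ENNReal.ofReal (K * ((Real.sqrt n + Real.sqrt n₁) * Real.sqrt d)) := hcont
        _ ≤ ENNReal.ofReal (1 / 8 * staticVariance N φ (cutoffStress e₁ e₂ A₁))
              + ENNReal.ofReal (K * ((Real.sqrt n + Real.sqrt n₁) * Real.sqrt d)) :=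
            add_le_add heng₁ le_rfl
        _ = ENNReal.ofReal (1 / 8 * staticVariance N φ (cutoffStress e₁ e₂ A₁)
              + K * ((Real.sqrt n + Real.sqrt n₁) * Real.sqrt d)) :=
            (ENNReal.ofReal_add (mul_nonneg (by norm_num) (hVnn N A₁)) (mul_nonneg hK hprod_nn)).symm
        _ ≤ ENNReal.ofReal ((1 / 2) * staticVariance N φ (cutoffStress e₁ e₂ A)) :=
            ENNReal.ofReal_le_ofReal hreal

/-- **The skeleton concludes the crux BY NAME.** `ShearStressHalfDrude` (route `AntiMazurCoboundaries`,
stmt-AtomisticToContinuum-14136) from the six registered stubs. -/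
theorem ShearStressHalfDrude_of : ShearStressHalfDrude :=
  shearStressHalfDrude_of_parts stub_massRelativeTaggedDecay stub_selfPartReduction
    stub_slowDistinctVanishes stub_compactCutoffDrude stub_cutoffContinuity stub_cutoffGaussianTail

end Summit.AtomisticToContinuum.HydrodynamicLimit.Cruxes.ShearStressHalfDrude.VelocityResamplingCutoff

end
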